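import Summits.NavierStokesRegularity.Statement
import Summits.NavierStokesRegularity.NavierStokesRegularity.Theorems.PlaneEnergyCeilingPlanarEnergyAPrioriHardyBridge
import Summits.NavierStokesRegularity.NavierStokesRegularity.Theorems.HardyPointSinkHardyTypeIExtraction
import Summits.NavierStokesRegularity.NavierStokesRegularity.Theorems.HardyPointSinkABForwardHardy
import HarnessLib

/-!
# Crux `PlanarEnergyAPriori` (stmt-NavierStokesRegularity-16855), route PlaneEnergyCeiling:
  an alternative second layer — the planar ceiling plus HardyPointSink's Liouville crux C3 close the summit

Helper file for the crux item stmt-NavierStokesRegularity-16855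
(`Summit.NavierStokesRegularity.NavierStokesRegularity.Theses.PlaneEnergyCeiling.PlanarEnergyAPriori`).

Route PlaneEnergyCeiling decides the summit through
`closes (h₁ : PlanarEnergyAPriori) (h₃ : PlanarEnergyLiouville) (h₅ : PlanarEnergyZoomA)`, whose open second
layer is the Liouville crux `PlanarEnergyLiouville` (stmt-16856: bounded ancient mild solutions with bounded
planar energies vanish — no Type-I information on the ancient solution). The cross-route edge
`hardyEnergyBound_of_planarEnergyAPriori : PlanarEnergyAPriori → HardyPointSink.HardyEnergyBound`
(`Theorems/PlaneEnergyCeilingPlanarEnergyAPrioriHardyBridge.lean`) plugs the planar crux into route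
HardyPointSink's deciding theorem, whose other two inputs are PROVED in tree
(`hardyTypeIExtraction_proof`, `abForwardHardy_proof`). Hence:

* `navierStokesRegularity_of_planarEnergyAPriori_of_noHardyTypeIAncient` —
  `PlanarEnergyAPriori → HardyPointSink.NoHardyTypeIAncient → NavierStokesRegularity`;
* `target_of_planarEnergyAPriori_of_noHardyTypeIAncient` (registered anchor) — the same with the
  route's own `Target` (`= PlanarEnergyAPriori ∧ BoundedPlanarEnergyRegularity`) as conclusion.

So the route has a SECOND admissible second layer: HardyPointSink's C3 `NoHardyTypeIAncient`
(stmt-NavierStokesRegularity-7980), a Liouville statement about ancient solutions that are, in addition to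
bounded and mild, SUITABLE, TYPE I (`typeIBound < ∞`) and Hardy-bounded — structure that the planar route's
own Liouville crux 16856 does not offer (it has the stronger planar bound instead of the Hardy bound, but no
Type-I rate and no local energy inequality). For the planners: cruxes 16856 and 7980 are now interchangeable
as the second input next to 16855; 7980 is "closed in one line from KNSS (L)" per its docstring.
-/

noncomputable section

-- Problem = summit for this single-conjunct summit: the duplicate namespace component is deliberate.
set_option linter.dupNamespace false

namespace Summit.NavierStokesRegularity.NavierStokesRegularity.Theorems.PlanarEnergyAPriori

open Summit.NavierStokesRegularity.NavierStokesRegularity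

/-- **Planar ceiling + HardyPointSink's Liouville crux C3 ⇒ the summit.** The planar crux gives the
Hardy crux C2 (`hardyEnergyBound_of_planarEnergyAPriori`); HardyPointSink's deciding theorem `closes`
needs besides C2 and C3 only `HardyTypeIExtraction` and `ABForwardHardy`, both proved in tree. -/
theorem navierStokesRegularity_of_planarEnergyAPriori_of_noHardyTypeIAncient
    (h₁ : Theses.PlaneEnergyCeiling.PlanarEnergyAPriori)
    (h₂ : Theses.HardyPointSink.NoHardyTypeIAncient) : _root_.NavierStokesRegularity :=
  Theses.HardyPointSink.closes (hardyEnergyBound_of_planarEnergyAPriori h₁) h₂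
    Theorems.hardyTypeIExtraction_proof Theorems.abForwardHardy_proof

/-- **Registered anchor `target_of_planarEnergyAPriori_of_noHardyTypeIAncient`: an alternative second
layer for route PlaneEnergyCeiling.** The route's target `X = PlanarEnergyAPriori ∧
BoundedPlanarEnergyRegularity` follows from the planar crux together with HardyPointSink's Liouville
crux C3 (in place of `PlanarEnergyLiouville ∧ PlanarEnergyZoomA`): the second conjunct is Clay (A) for
the datum, an instance of the summit statement just derived. -/
theorem target_of_planarEnergyAPriori_of_noHardyTypeIAncient :
    Summit.NavierStokesRegularity.NavierStokesRegularity.Theses.PlaneEnergyCeiling.PlanarEnergyAPriori →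
    Summit.NavierStokesRegularity.NavierStokesRegularity.Theses.HardyPointSink.NoHardyTypeIAncient →
    Summit.NavierStokesRegularity.NavierStokesRegularity.Theses.PlaneEnergyCeiling.Target := by
  intro h₁ h₂
  refine ⟨h₁, fun ν hν u₀ hsm hdiv hdec _ => ?_⟩
  exact navierStokesRegularity_of_planarEnergyAPriori_of_noHardyTypeIAncient h₁ h₂ ν hν u₀ hsm hdiv hdec

end Summit.NavierStokesRegularity.NavierStokesRegularity.Theorems.PlanarEnergyAPriori

end
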